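import Summits.ABC.ABC.Theorems.PeterssonLowerBound.Negative.GL2PairBarrier

/-!
# The conical-point count: which auxiliary factors can pay for a `Sym²`-zero repulsion
# (crux `DefiniteXi.PeterssonLowerBound`, stmt-ABC-10870; negative-side support, line lead c7; theorems only)

`GL2PairBarrier.lean` (lead c6) records that no positive auxiliary Euler product built from
`GL(1)`, `GL(2)` and `GL(2) × GL(2)` factors — monomials `U_i(u) U_j(v)` with
`(i, j) ∈ {(0,0),(1,0),(0,1),(1,1),(2,0),(0,2)}` in the good-prime log-coefficient
`c(u,v) = Σ m_{ij} U_i(u) U_j(v)`, `u = 2cos kθ_p`, `v = 2cos kφ_p`, `U₀ = 1`, `U₁(x) = x`,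
`U₂(x) = x² − 1` — lets the `Sym²`-multiplicities exceed the pole order (`m₂₀ + m₀₂ ≤ m₀₀`), and its
docstring leaves three conceivable escapes: `Sym² f × g` (`GL₃ × GL₂`), `Sym² f × Sym² g`
(`GL₃ × GL₃`) and `Sym⁴ f` (`GL₅`). This file settles which of them (and of everything else up to
degree four in each form) can actually pay, by the one evaluation that drives all of c6's counts:
the CONICAL POINT `(u, v) = (0, 0)` (`θ_p = φ_p = π/2`, the "all-supersingular local model" of the
crux notes). With `U₃(x) = x³ − 2x`, `U₄(x) = x⁴ − 3x² + 1` one has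
`U₀(0) = 1, U₁(0) = 0, U₂(0) = −1, U₃(0) = 0, U₄(0) = 1`, hence for ALL 25 multiplicities
`m_{ij}`, `0 ≤ i, j ≤ 4`:

  `c(0,0) = m₀₀ − m₂₀ − m₀₂ + m₂₂ + m₄₀ + m₀₄ − m₄₂ − m₂₄ + m₄₄`

(`conicalPoint_count`). Consequences, read off at once:

* every monomial with `i` or `j` ODD is invisible at the conical point. So the factors with a
  classical or known analytic theory beyond `GL(2) × GL(2)` that one might hope to add —
  `L(s, Sym² f × g)` (`(2,1)`: inside Garrett's triple product `L(s, f × f × g) =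
  L(s, Sym² f × g) L(s, g)`, Garrett 1987 / Piatetski-Shapiro–Rallis 1987, a classical integral
  representation on `Sp₆`), `L(s, Sym³ f)` (`(3,0)`, Kim–Shahidi 2002, `GL₄`),
  `L(s, Sym³ f × g)` (`(3,1)`, `GL₄ × GL₂`), and `(1,2), (0,3), (1,3), (3,2), (2,3), (3,3),
  (4,1), (1,4), (4,3), (3,4)` — change NOTHING in the count: with them and without
  `(2,2), (4,0), (0,4), (4,4)` one still has `m₂₀ + m₀₂ ≤ m₀₀`
  (`symmSq_multiplicity_le_pole_order_of_no_even_pair`);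
* the ONLY factors that can pay for `m₂₀ + m₀₂ > m₀₀` — which each classical shape needs:
  Goldfeld–Hoffstein–Lieman repulsion (`m₂₀ > m₀₀`), Siegel's simple-pole lemma for two members of
  the family (`m₂₀, m₀₂ ≥ 1 = m₀₀`), Landau–Page for two forms (`m₂₀ + m₀₂ > m₀₀`) — are
  `(2,2)` = `L(s, Sym² f × Sym² g)` (`GL₃ × GL₃`: Hoffstein–Lockhart 1994, Thm. 0.1, with
  `m₀₀ = m₂₀ = m₀₂ = m₂₂ = 1`, `c(0,0) = 0`), `(4,0)/(0,4)` = `L(s, Sym⁴ f)` (`GL₅`: Kim 2003; the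
  GHL auxiliary `ζ² L(Sym² f)³ L(Sym⁴ f)` has `c(0,0) = 2 − 3 + 1 = 0`) and `(4,4)`
  (`GL₅ × GL₅`). Both tight cases sit exactly on the cone.
* Garrett's factor DOES enlarge the class of positive series — `garrett_deuringHeilbronn_series_nonneg`
  (`ζ² L(g) L(Sym² f)² L(Sym² f × g)`: `u²(2 + v) ≥ 0`, a Deuring–Heilbronn shape in which, unlike
  `deuringHeilbronn_shape_decouples`, the auxiliary form survives) and
  `garrett_siegelPair_series_nonneg` (`ζ² L(g) L(Sym² f) L(Sym² g) L(Sym² f × g)`: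
  `u²(1 + v) + v² ≥ 0`, both symmetric squares present simply) — but only with a DOUBLE pole
  (`m₀₀ = 2 = m₂₀ + m₀₂`, forced by the count), i.e. in the derivative-carrying form of Siegel's
  lemma that lead c6 carried to the end (dichotomy "restatement of the hypothesis, or a real zero
  of the coupling factor", `Cruxes/PeterssonLowerBound/PICKED.md` of c6); and a Deuring–Heilbronn
  coupling only repels zeros of `L(g) · L(Sym² f × g)`, for which no zero near `1` can be produced.

So the named fact the crux line isolates (`Kim2003_symmFourL_nonCM_entire_polyBound`, the `(4,0)`
carrier) or Hoffstein–Lockhart's `GL₃ × GL₃` pair continuation (the `(2,2)` carrier) is needed by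
every zero-repulsion proof of the crux, whatever odd-degree factors are thrown in. This file makes
no claim about the crux itself (a theorem in print); it is filed `--supports stmt-ABC-10870` as
negative-side evidence (theorems only, no definitions). [cite: HoffsteinLockhart1994, Thm. 0.1 and Appendix]
[cite: IwaniecKowalski2004, Thm. 5.44]
-/

set_option linter.dupNamespace false

namespace Summit.ABC.ABC.Theorems.PeterssonLowerBound.Negative

variable {m₀₀ m₁₀ m₀₁ m₁₁ m₂₀ m₀₂ m₂₁ m₁₂ m₂₂ m₃₀ m₀₃ m₃₁ m₁₃ m₃₂ m₂₃ m₃₃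
  m₄₀ m₀₄ m₄₁ m₁₄ m₄₂ m₂₄ m₄₃ m₃₄ m₄₄ : ℤ}

/-- **The conical-point count.** If the good-prime log-coefficient of an auxiliary Euler product
`∏_{i,j ≤ 4} L(s, Symⁱ f × Symʲ g)^{m_{ij}}`, written in the `SU(2)`-characters
`U₀ = 1, U₁ = x, U₂ = x² − 1, U₃ = x³ − 2x, U₄ = x⁴ − 3x² + 1` of `u = 2cos kθ_p`, `v = 2cos kφ_p`,
is non-negative on `[-2,2]²`, then evaluation at the conical point `(0,0)` (where every odd
character vanishes, `U₂(0) = −1`, `U₄(0) = 1`) gives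
`m₂₀ + m₀₂ + m₄₂ + m₂₄ ≤ m₀₀ + m₂₂ + m₄₀ + m₀₄ + m₄₄`: the `Sym²`-multiplicities can exceed the
pole order `m₀₀` only at the expense of a `Sym² f × Sym² g` (`GL₃ × GL₃`), a `Sym⁴` (`GL₅`) or a
`Sym⁴ f × Sym⁴ g` factor — never through factors with an odd symmetric power on either side
(`Sym² f × g` à la Garrett, `Sym³ f`, `Sym³ f × g`, …). [folklore] -/
theorem conicalPoint_count
    (h : ∀ u ∈ Set.Icc (-2 : ℝ) 2, ∀ v ∈ Set.Icc (-2 : ℝ) 2,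
      0 ≤ (m₀₀ : ℝ) + m₁₀ * u + m₀₁ * v + m₁₁ * (u * v) + m₂₀ * (u ^ 2 - 1) + m₀₂ * (v ^ 2 - 1)
        + m₂₁ * ((u ^ 2 - 1) * v) + m₁₂ * (u * (v ^ 2 - 1)) + m₂₂ * ((u ^ 2 - 1) * (v ^ 2 - 1))
        + m₃₀ * (u ^ 3 - 2 * u) + m₀₃ * (v ^ 3 - 2 * v)
        + m₃₁ * ((u ^ 3 - 2 * u) * v) + m₁₃ * (u * (v ^ 3 - 2 * v))
        + m₃₂ * ((u ^ 3 - 2 * u) * (v ^ 2 - 1)) + m₂₃ * ((u ^ 2 - 1) * (v ^ 3 - 2 * v))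
        + m₃₃ * ((u ^ 3 - 2 * u) * (v ^ 3 - 2 * v))
        + m₄₀ * (u ^ 4 - 3 * u ^ 2 + 1) + m₀₄ * (v ^ 4 - 3 * v ^ 2 + 1)
        + m₄₁ * ((u ^ 4 - 3 * u ^ 2 + 1) * v) + m₁₄ * (u * (v ^ 4 - 3 * v ^ 2 + 1))
        + m₄₂ * ((u ^ 4 - 3 * u ^ 2 + 1) * (v ^ 2 - 1)) + m₂₄ * ((u ^ 2 - 1) * (v ^ 4 - 3 * v ^ 2 + 1))
        + m₄₃ * ((u ^ 4 - 3 * u ^ 2 + 1) * (v ^ 3 - 2 * v))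
        + m₃₄ * ((u ^ 3 - 2 * u) * (v ^ 4 - 3 * v ^ 2 + 1))
        + m₄₄ * ((u ^ 4 - 3 * u ^ 2 + 1) * (v ^ 4 - 3 * v ^ 2 + 1))) :
    m₂₀ + m₀₂ + m₄₂ + m₂₄ ≤ m₀₀ + m₂₂ + m₄₀ + m₀₄ + m₄₄ := by
  have h0 := h 0 (mem_sq (by norm_num) (by norm_num)) 0 (mem_sq (by norm_num) (by norm_num))
  have : ((m₂₀ + m₀₂ + m₄₂ + m₂₄ : ℤ) : ℝ) ≤ ((m₀₀ + m₂₂ + m₄₀ + m₀₄ + m₄₄ : ℤ) : ℝ) := by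
    push_cast; linarith
  exact_mod_cast this

/-- **Odd-degree factors do not help.** With every monomial of degree `≤ 4` in each form allowed
EXCEPT the even pairs `(2,2), (4,0), (0,4), (4,4)` (and the sign-negative `(4,2), (2,4)`, which
could only hurt), positivity on `[-2,2]²` still forces `m₂₀ + m₀₂ ≤ m₀₀`: the `Sym²`-zeros never
outnumber the pole. In particular neither Garrett's triple product (`Sym² f × g`, `GL₃ × GL₂`) nor
Kim–Shahidi's `Sym³` (`GL₄`, `GL₄ × GL₂`, `GL₄ × GL₄`) can carry a Goldfeld–Hoffstein–Lieman
repulsion (`m₂₀ > m₀₀`), a simple-pole Siegel lemma for two members of the family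
(`m₂₀ = m₀₂ = 1 = m₀₀`) or a Landau–Page statement for two forms. [folklore] -/
theorem symmSq_multiplicity_le_pole_order_of_no_even_pair
    (h : ∀ u ∈ Set.Icc (-2 : ℝ) 2, ∀ v ∈ Set.Icc (-2 : ℝ) 2,
      0 ≤ (m₀₀ : ℝ) + m₁₀ * u + m₀₁ * v + m₁₁ * (u * v) + m₂₀ * (u ^ 2 - 1) + m₀₂ * (v ^ 2 - 1)
        + m₂₁ * ((u ^ 2 - 1) * v) + m₁₂ * (u * (v ^ 2 - 1))
        + m₃₀ * (u ^ 3 - 2 * u) + m₀₃ * (v ^ 3 - 2 * v)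
        + m₃₁ * ((u ^ 3 - 2 * u) * v) + m₁₃ * (u * (v ^ 3 - 2 * v))
        + m₃₂ * ((u ^ 3 - 2 * u) * (v ^ 2 - 1)) + m₂₃ * ((u ^ 2 - 1) * (v ^ 3 - 2 * v))
        + m₃₃ * ((u ^ 3 - 2 * u) * (v ^ 3 - 2 * v))
        + m₄₁ * ((u ^ 4 - 3 * u ^ 2 + 1) * v) + m₁₄ * (u * (v ^ 4 - 3 * v ^ 2 + 1))
        + m₄₃ * ((u ^ 4 - 3 * u ^ 2 + 1) * (v ^ 3 - 2 * v))
        + m₃₄ * ((u ^ 3 - 2 * u) * (v ^ 4 - 3 * v ^ 2 + 1))) :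
    m₂₀ + m₀₂ ≤ m₀₀ := by
  have h0 := h 0 (mem_sq (by norm_num) (by norm_num)) 0 (mem_sq (by norm_num) (by norm_num))
  have : ((m₂₀ + m₀₂ : ℤ) : ℝ) ≤ (m₀₀ : ℝ) := by push_cast; linarith
  exact_mod_cast this

/-- **The simple-pole Siegel shape for two members of the family needs an even pair.** Under the
same positivity (no `(2,2), (4,0), (0,4), (4,4)`; any odd-degree factors), an auxiliary containing
both `L(s, Sym² f)` and `L(s, Sym² g)` (`1 ≤ m₂₀`, `1 ≤ m₀₂`) has at least a DOUBLE pole at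
`s = 1` — so Siegel's product-residue lemma (simple pole, residue a pure product) is unavailable,
and only its derivative-carrying double-pole form remains (lead c6). Hoffstein–Lockhart's
`ζ · L(Sym² f) · L(Sym² g) · L(Sym² f × Sym² g)` escapes exactly through `m₂₂ = 1`. [folklore] -/
theorem two_le_pole_order_of_two_symmSq
    (h : ∀ u ∈ Set.Icc (-2 : ℝ) 2, ∀ v ∈ Set.Icc (-2 : ℝ) 2,
      0 ≤ (m₀₀ : ℝ) + m₁₀ * u + m₀₁ * v + m₁₁ * (u * v) + m₂₀ * (u ^ 2 - 1) + m₀₂ * (v ^ 2 - 1)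
        + m₂₁ * ((u ^ 2 - 1) * v) + m₁₂ * (u * (v ^ 2 - 1))
        + m₃₀ * (u ^ 3 - 2 * u) + m₀₃ * (v ^ 3 - 2 * v)
        + m₃₁ * ((u ^ 3 - 2 * u) * v) + m₁₃ * (u * (v ^ 3 - 2 * v))
        + m₃₂ * ((u ^ 3 - 2 * u) * (v ^ 2 - 1)) + m₂₃ * ((u ^ 2 - 1) * (v ^ 3 - 2 * v))
        + m₃₃ * ((u ^ 3 - 2 * u) * (v ^ 3 - 2 * v))
        + m₄₁ * ((u ^ 4 - 3 * u ^ 2 + 1) * v) + m₁₄ * (u * (v ^ 4 - 3 * v ^ 2 + 1))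
        + m₄₃ * ((u ^ 4 - 3 * u ^ 2 + 1) * (v ^ 3 - 2 * v))
        + m₃₄ * ((u ^ 3 - 2 * u) * (v ^ 4 - 3 * v ^ 2 + 1)))
    (h20 : 1 ≤ m₂₀) (h02 : 1 ≤ m₀₂) : 2 ≤ m₀₀ := by
  have := symmSq_multiplicity_le_pole_order_of_no_even_pair h
  omega

/-- **The tight even carriers sit exactly on the cone.** The Goldfeld–Hoffstein–Lieman auxiliary
`ζ² L(Sym² f)³ L(Sym⁴ f)` (`m₀₀ = 2, m₂₀ = 3, m₄₀ = 1`) and the Hoffstein–Lockhart auxiliary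
`ζ L(Sym² f) L(Sym² g) L(Sym² f × Sym² g)` (`m₀₀ = m₂₀ = m₀₂ = m₂₂ = 1`) both have `c(0,0) = 0`:
their good-prime log-coefficients are `(u² − 1)²·1 + … = (u⁴ − u²)`-type squares vanishing at the
conical point — `2 + 3(u²−1) + (u⁴ − 3u² + 1) = u⁴ = (u²)²` and
`1 + (u²−1) + (v²−1) + (u²−1)(v²−1) = u²v²`. [folklore] -/
theorem tight_even_carriers_logCoeff (u v : ℝ) :
    (2 : ℝ) + 3 * (u ^ 2 - 1) + (u ^ 4 - 3 * u ^ 2 + 1) = (u ^ 2) ^ 2 ∧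
      (1 : ℝ) + (u ^ 2 - 1) + (v ^ 2 - 1) + (u ^ 2 - 1) * (v ^ 2 - 1) = (u * v) ^ 2 := by
  constructor <;> ring

/-- **Garrett's factor enlarges the positive class — Deuring–Heilbronn shape, double pole.**
`ζ² · L(g) · L(Sym² f)² · L(Sym² f × g)` (`m₀₀ = 2, m₀₁ = 1, m₂₀ = 2, m₂₁ = 1`) has good-prime
log-coefficient `2 + v + 2(u² − 1) + (u² − 1)v = u²(2 + v) ≥ 0` on `[-2,2]²`: `L(Sym² f)` cancels
every pole AND the auxiliary form survives (contrast `deuringHeilbronn_shape_decouples` for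
`GL(2) × GL(2)` data). It repels only zeros of `L(g) · L(Sym² f × g)`, for which no real zero near
`1` can be produced, so it proves nothing about the crux; recorded so that no line is spent on it.
[folklore] -/
theorem garrett_deuringHeilbronn_series_nonneg {u v : ℝ} (hv : v ∈ Set.Icc (-2 : ℝ) 2) :
    0 ≤ (2 : ℝ) + v + 2 * (u ^ 2 - 1) + (u ^ 2 - 1) * v := by
  have key : (2 : ℝ) + v + 2 * (u ^ 2 - 1) + (u ^ 2 - 1) * v = u ^ 2 * (2 + v) := by ring
  rw [key]
  exact mul_nonneg (sq_nonneg u) (by linarith [hv.1])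

/-- **Garrett's factor enlarges the positive class — two symmetric squares, double pole.**
`ζ² · L(g) · L(Sym² f) · L(Sym² g) · L(Sym² f × g)` (`m₀₀ = 2, m₀₁ = m₂₀ = m₀₂ = m₂₁ = 1`) has
good-prime log-coefficient `2 + v + (u² − 1) + (v² − 1) + (u² − 1)v = u²(1 + v) + v² ≥ 0` for
`|u| ≤ 2` and every real `v` (for `v ≤ -1` use `u² ≤ 4`: `≥ (v + 2)²`). Both symmetric squares occur simply — the
two-member shape Siegel's argument wants — but, as `two_le_pole_order_of_two_symmSq` forces, with a
double pole, hence only in the derivative-carrying form of Siegel's lemma whose outcome is the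
inconclusive dichotomy of lead c6. The Garrett analogue of `symmSq_pair_rankin_logCoeff_nonneg`.
[folklore] -/
theorem garrett_siegelPair_series_nonneg {u : ℝ} (hu : u ∈ Set.Icc (-2 : ℝ) 2) (v : ℝ) :
    0 ≤ (2 : ℝ) + v + (u ^ 2 - 1) + (v ^ 2 - 1) + (u ^ 2 - 1) * v := by
  have key : (2 : ℝ) + v + (u ^ 2 - 1) + (v ^ 2 - 1) + (u ^ 2 - 1) * v = u ^ 2 * (1 + v) + v ^ 2 := by
    ring
  rw [key]
  have hu2 : u ^ 2 ≤ 4 := by nlinarith [hu.1, hu.2]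
  rcases le_or_gt (-1 : ℝ) v with h1 | h1
  · exact add_nonneg (mul_nonneg (sq_nonneg u) (by linarith)) (sq_nonneg v)
  · -- `v < -1`: `u²(1+v) ≥ 4(1+v)`, and `4(1+v) + v² = (v+2)²`
    have : 4 * (1 + v) ≤ u ^ 2 * (1 + v) := by nlinarith [sq_nonneg u]
    nlinarith [sq_nonneg (v + 2)]

/-- **At the conical point the two Garrett series are extremal**: both have `c(0,0) = 0`, i.e.
they exhaust the budget `m₀₀ − m₂₀ − m₀₂ = 0` of `conicalPoint_count` with no even pair present.
[folklore] -/
theorem garrett_series_conical_values :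
    (2 : ℝ) + 0 + 2 * ((0 : ℝ) ^ 2 - 1) + ((0 : ℝ) ^ 2 - 1) * 0 = 0 ∧
      (2 : ℝ) + 0 + ((0 : ℝ) ^ 2 - 1) + ((0 : ℝ) ^ 2 - 1) + ((0 : ℝ) ^ 2 - 1) * 0 = 0 := by
  constructor <;> norm_num

end Summit.ABC.ABC.Theorems.PeterssonLowerBound.Negative
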